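import Literature.Topology.FourManifolds.SliceDiscZeroFraming
import Literature.Topology.FourManifolds.DehnSurgeryTwistProofs
import Literature.Topology.FourManifolds.KnotGroupAbelianization
import Literature.Topology.FourManifolds.CappellShanesonHomology
import Literature.Topology.FourManifolds.CircleDiffeotopyProofs
import Literature.AlgebraicTopology.FundamentalGroup.CircleAndTorus
import Literature.AlgebraicTopology.SingularHomology.HOneProducts
import Literature.AlgebraicTopology.SingularHomology.SphereComplementProofs
import Literature.AlgebraicTopology.SingularHomology.MayerVietorisExactness
import Mathlib.Analysis.Normed.Module.Connected
import HarnessLib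

/-!
# The homology of integral Dehn surgery on a knot: `S³₀(K)` is a homology `S² × S¹`

Topic `Literature/Topology/FourManifolds`; written in the fact seat of
`Literature.Topology.FourManifolds.isUnknot_of_isIntegralSurgery_zero` (Property R; D. Gabai,
*Foliations and the topology of 3-manifolds. III*, J. Differential Geom. 26 (1987), Cor. 8.3 and
Remark 8.5) as a **proved** ingredient of the printed line. Gabai, Definitions 8.1 (p. 524):
*"The manifold `M` is obtained by zero frame surgery on a knot `k` in `N`, if it is obtained by
performing Dehn surgery to the longitude. Note that if `N` is a homology sphere, then `M` is the
unique manifold obtained by Dehn surgery on `k` which is a homology `S² × S¹`"*; proof of Cor. 8.2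
(p. 525): *"Note that `Ŝ` generates `H₂(M)`"*; and the proofs of Cor. 8.3 (*"Since `Ŝ` generates
`H₂(M)` the result follows"*) and Cor. 8.6 (*"Since `H₂(∂W) = ℤ`, `∂W` is obtained by zero frame
surgery on a knot"*) use it. None of this was in the tree. For the tree's relational integral
surgery `Literature.Topology.FourManifolds.IsIntegralSurgery IY Y K m` (`DehnSurgery.lean`: `Y` is
the open gluing of the knot complement `S³ ∖ K` and the open solid torus `D̊² × 𝕊¹` along an
`m`-framed tubular neighbourhood `ν`) and Mathlib's singular homology
(`Literature.AlgebraicTopology.SingularHomology.singularHomology ℤ ℤ Y n`) this file **proves**: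

* `IsIntegralSurgery.nonempty_addEquiv_singularHomology_one` (and `…linearEquiv…`):
  **`H₁(S³_m(K); ℤ) ≅ ℤ/m`** (`ZMod m.natAbs`; the standard computation "`H₁` of surgery on a
  framed link is presented by the linking matrix", here a `1 × 1` matrix `(m)`);
* `IsIntegralSurgery.isZero_singularHomology_two`: **`H₂(S³_m(K); ℤ) = 0` for `m ≠ 0`**;
* `IsIntegralSurgery.nonempty_addEquiv_singularHomology_one_int`,
  `IsIntegralSurgery.nonempty_addEquiv_singularHomology_two_int`: **`H₁(S³_0(K); ℤ) ≅ ℤ` and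
  `H₂(S³_0(K); ℤ) ≅ ℤ`** — zero frame surgery is a homology `S² × S¹` (Gabai, Def. 8.1);
* `IsIntegralSurgery.nonempty_addEquiv_singularHomology_one_int_iff`: **`H₁(S³_m(K); ℤ) ≅ ℤ` iff
  `m = 0`** — among integral surgeries on `K`, the zero frame surgery is the unique homology
  `S² × S¹` (Gabai, Def. 8.1, "the unique manifold obtained by Dehn surgery on `k` which is a
  homology `S² × S¹`", integral case).

## Proof (Mayer–Vietoris, Hatcher (2002), §2.2, pp. 149–150)

Write `Y = U ∪ V`, `U = jA(S³ ∖ K) ≅ S³ ∖ K`, `V = jB(D̊² × 𝕊¹) ≃ 𝕊¹`,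
`U ∩ V ≅ 𝕊¹ × (D̊² ∖ 0)` through `(u, w) ↦ jA (ν (u, w)) = jB (‖w‖u, w/‖w‖)`
(`Literature.Topology.FourManifolds.DehnSurgeryDatum.homeomorphW`). In the exact sequence
`H₂(U) ⊕ H₂(V) → H₂(Y) →δ H₁(U ∩ V) →φ H₁(U) ⊕ H₁(V) →ψ H₁(Y) →δ H₀(U ∩ V) → H₀(U) ⊕ H₀(V)`:

* `H₂(U) = H₂(S³ ∖ K) = 0` (Alexander duality; the tree's Hatcher Prop. 2B.1 (b),
  `SphereComplement.isZero_compl_range_of_isEmbedding_holds`), `H₂(V) = H₂(𝕊¹) = 0`, so `δ` is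
  injective and `H₂(Y) ≅ ker φ`;
* `U ∩ V` is path connected, so `H₀(U ∩ V) → H₀(U)` is injective, the second `δ` vanishes, `ψ`
  is onto and `H₁(Y) ≅ (H₁(U) ⊕ H₁(V)) / im φ`;
* `H₁(U) = ℤ·h(μ)` (meridian; the tree's `H₁(S³ ∖ K) ≅ ℤ`,
  `Knot.TubularNbhd.bijective_zpowersHom_abelianizationOf_meridian`, through the Hurewicz
  isomorphism `hurewiczOneAb` of Hatcher Thm. 2A.1), `H₁(V) = ℤ·h(ℓ_V)` (core-parallel loop;
  `D̊² × 𝕊¹ ≃ 𝕊¹` and `π₁(𝕊¹) = ⟨ω⟩ ≅ ℤ`, Hatcher Thm. 1.7, the tree's `zpowers_addCircleLoop`),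
  `H₁(U ∩ V) = ℤ·A + ℤ·B` with `A` the longitudinal loop `(e^{2πit}, ½)` and `B` the meridional loop
  `(1, ½e^{2πit})` of the model (degree-one Künneth, the tree's
  `singularHomology.map_inl_fst_add_map_inr_snd_one`);
* in `U`, `A ↦ h(longitude of ν) = m·h(μ)` (the definition of `HasFraming m` read through the
  Hurewicz homomorphism) and `B ↦ h(μ)`; in `V`, `A ↦ 0` (a meridian circle of the new solid torus)
  and `B ↦ h(ℓ_V)`. Hence `φ(iA + jB) = ((im + j)·h(μ), -j·h(ℓ_V))`, `ker φ = ℤ·A` for `m = 0` and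
  `0` for `m ≠ 0`, and `(a, b) ↦ a + b mod m` identifies `coker φ` with `ℤ/m`.

## Main definitions and statements

* for the standard loop `Knot.TubularNbhd.circleLoop` (`t ↦ (cos 2πt, sin 2πt)` of `𝕊¹ ⊆ ℝ²`, `DehnSurgeryTwistProofs.lean`): `zpowers_fromPath_circleLoop`,
  `fromPath_circleLoop_zpow_eq_one_iff` (`π₁(𝕊¹) = ⟨[ω]⟩`, infinite cyclic, transported from `ℝ/2πℤ`),
  `exists_eq_zsmul_loopClass_circleLoop`, `zsmul_loopClass_circleLoop_injective` (`H₁(𝕊¹; ℤ) = ℤ·h(ω)`);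
* `solidTorus.homotopyEquiv : D̊² × 𝕊¹ ≃ₕ 𝕊¹`, `solidTorus.loop`,
  `solidTorus.exists_eq_zsmul_loopClass_loop`, `solidTorus.zsmul_loopClass_loop_injective`,
  `solidTorus.isZero_singularHomology_two`;
* `puncturedDisc.loop`, `puncturedDisc.exists_eq_zsmul_loopClass_loop`; the model
  `surgeryModel` = `𝕊¹ × (D̊² ∖ 0)` with `lonLoop`, `merLoop`, `exists_eq_zsmul_add_zsmul`,
  `toComplement ν`, `toSolidTorus` and the four loop identifications;
* `Knot.TubularNbhd.exists_eq_zsmul_loopClass_meridian`, `zsmul_loopClass_meridian_injective`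
  (`H₁(S³ ∖ K; ℤ) = ℤ·h(μ)` in terms of Hurewicz classes);
* `DehnSurgeryDatum K Y` (the topological body of `IsIntegralSurgery`),
  `IsIntegralSurgery.exists_dehnSurgeryDatum`, the cover `U`, `V`, the homeomorphisms
  `homeomorphU/V/W`, the generators `gU`, `gV`, `genA`, `genB`, the Mayer–Vietoris maps
  `mvφ`, `mvψ`, `mvδ`, `mvφ_apply_eq_zero_iff`, `mono_mvδ_one`, `epi_mvψ_one`,
  `DehnSurgeryDatum.isZero_singularHomology_two`, `nonempty_addEquiv_singularHomology_two`,
  `nonempty_addEquiv_singularHomology_one`;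
* the `IsIntegralSurgery` statements listed above.

## References

* D. Gabai, *Foliations and the topology of 3-manifolds. III*, J. Differential Geom. 26 (1987)
  479–536: Definitions 8.1 (p. 524), Cor. 8.2 and its proof (pp. 524–525), proofs of Cor. 8.3 and
  Cor. 8.6 (pp. 525–526). [GabaiJDG1987]
* A. Hatcher, *Algebraic Topology*, CUP 2002: Thm. 1.7, Prop. 1.12, §2.2 (Mayer–Vietoris,
  pp. 149–150), Prop. 2.7, Thm. 2A.1, Prop. 2B.1, Thm. 3B.6. [HatcherAT2002]
* D. Rolfsen, *Knots and Links*, Publish or Perish (1976), §9.F–G (surgery). [Rolfsen1976]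
* R. Gompf, A. Stipsicz, *4-Manifolds and Kirby Calculus* (1999), §5.3 (Dehn surgery; `H₁` of
  surgery on a framed link from the linking matrix). [GompfStipsicz1999]
* R. H. Crowell, R. H. Fox, *Introduction to Knot Theory* (1963), Ch. VIII (1.1)–(1.2). [CrowellFox1963]

## Design notes

* Everything is proved; the new definitions (all with bodies) are the loops, maps, homotopy
  equivalence and homeomorphisms of the Mayer–Vietoris cover and the structure `DehnSurgeryDatum`
  (the existential body of `IsIntegralSurgery` with the smoothness of `jA`, `jB` forgotten, in the
  manner of `CircleSurgeryDatum` of `CappellShanesonHomology.lean`). No named fact is introduced.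
* Spaces live in `Type`: `singularHomology.map` relates spaces of one universe and `𝕊 n : Type`
  (as in `SphereSurgeryHomology.lean`, `CappellShanesonHomology.lean`); the datum itself is
  universe polymorphic.
* Integer multiples of homology classes are `zsmul`, as in `HurewiczOne.lean`; the results are
  stated as additive equivalences `≃+` (and once as `≃ₗ[ℤ]` via `AddEquiv.toIntLinearEquiv`).
* Reused from the tree rather than re-proved: `Knot.TubularNbhd.loopClass_longitude_eq_of_hasFraming`
  (`SliceDiscZeroFraming.lean`), `puncturedDisc`, `puncturedDisc.radial/half/homotopyEquiv`
  (`CappellShanesonHomology.lean`), `addCircleHomeomorph` (`CircleDiffeotopyProofs.lean`),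
  `Knot.TubularNbhd.circleLoop` (`DehnSurgeryTwistProofs.lean`).
* No declaration in this file uses `sorry`.
-/

noncomputable section

open CategoryTheory Limits Set Function Metric Topology
open Literature.AlgebraicTopology.SingularHomology Literature.AlgebraicTopology.FundamentalGroup

namespace Literature.Topology.FourManifolds

/-- Local notation: `𝔼 n` is the model Euclidean space `EuclideanSpace ℝ (Fin n)`. -/
local notation "𝔼 " n:arg => EuclideanSpace ℝ (Fin n)

/-- Local notation: `𝕊 n` is the unit sphere in `EuclideanSpace ℝ (Fin (n + 1))`. -/
local notation "𝕊 " n:arg => (Metric.sphere (0 : EuclideanSpace ℝ (Fin (n + 1))) 1)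

open Knot.TubularNbhd (circleLoop circleLoop_apply circlePoint_two_pi_mul_zero
  circlePoint_two_pi_mul_one)

/-! ### Loop classes of pointwise equal loops; transport along homeomorphisms -/

/-- Two loops which agree pointwise (possibly with syntactically different base points) define
the same singular `1`-simplex. [folklore] -/
theorem ofPath_congr_fun {X : Type*} [TopologicalSpace X] {x y : X} {γ : Path x x} {γ' : Path y y}
    (h : ∀ t, γ t = γ' t) : SingularSimplex.ofPath γ = SingularSimplex.ofPath γ' := by
  apply SingularSimplex.toContinuousMap_injective
  ext s : 1
  rw [SingularSimplex.ofPath_apply, SingularSimplex.ofPath_apply, h]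

/-- Two loops which agree pointwise have the same Hurewicz class. [folklore] -/
theorem loopClass_congr_fun {X : Type} [TopologicalSpace X] {x y : X} {γ : Path x x}
    {γ' : Path y y} (h : ∀ t, γ t = γ' t) :
    loopClass ℤ ℤ (1 : ℤ) γ = loopClass ℤ ℤ (1 : ℤ) γ' :=
  loopClass_eq_of_ofPath_eq ℤ ℤ 1 _ _ (ofPath_congr_fun h)

/-- Transport along a homeomorphism is injective on singular homology. [folklore] -/
theorem singularHomology_map_homeomorph_injective {X X' : Type} [TopologicalSpace X]
    [TopologicalSpace X'] (e : X ≃ₜ X') (n : ℕ) :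
    Injective (singularHomology.map ℤ ℤ (e : C(X, X')) n) :=
  (ModuleCat.mono_iff_injective _).1 (inferInstanceAs (Mono (singularHomology.mapIso ℤ ℤ e n).hom))

/-- Transport along a homeomorphism is surjective on singular homology. [folklore] -/
theorem singularHomology_map_homeomorph_surjective {X X' : Type} [TopologicalSpace X]
    [TopologicalSpace X'] (e : X ≃ₜ X') (n : ℕ) :
    Surjective (singularHomology.map ℤ ℤ (e : C(X, X')) n) :=
  (ModuleCat.epi_iff_surjective _).1 (inferInstanceAs (Epi (singularHomology.mapIso ℤ ℤ e n).hom))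

/-- `fst (inl a) = a` in a binary biproduct of modules. [folklore] -/
theorem biprod_fst_inl_apply {R : Type} [CommRing R] {P Q : ModuleCat.{0} R} (a : P) :
    (biprod.fst : P ⊞ Q ⟶ P) ((biprod.inl : P ⟶ P ⊞ Q) a) = a := by
  rw [← ModuleCat.comp_apply, biprod.inl_fst, ModuleCat.id_apply]

/-- `snd (inl a) = 0` in a binary biproduct of modules. [folklore] -/
theorem biprod_snd_inl_apply {R : Type} [CommRing R] {P Q : ModuleCat.{0} R} (a : P) :
    (biprod.snd : P ⊞ Q ⟶ Q) ((biprod.inl : P ⟶ P ⊞ Q) a) = 0 := by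
  rw [← ModuleCat.comp_apply, biprod.inl_snd]
  rfl

/-! ### The standard loop `circleLoop`: `π₁(𝕊¹)` and `H₁(𝕊¹; ℤ)` are generated by it -/

/-- The unit circle is path connected. [folklore] -/
instance instPathConnectedSpaceSphereOne : PathConnectedSpace (𝕊 1) := by
  refine isPathConnected_iff_pathConnectedSpace.mp (isPathConnected_sphere ?_ _ zero_le_one)
  rw [← Module.finrank_eq_rank, finrank_euclideanSpace, Fintype.card_fin]
  norm_num

/-- `addCircleHomeomorph 0 = circlePoint 0`. [folklore] -/
theorem addCircleHomeomorph_zero : addCircleHomeomorph (0 : AddCircle (2 * Real.pi)) = circlePoint 0 := by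
  rw [← QuotientAddGroup.mk_zero]
  exact addCircleHomeomorph_coe 0

/-- The standard loop is the image of the winding loop `t ↦ t·2π` of `ℝ/2πℤ` under the
homeomorphism `ℝ/2πℤ ≃ₜ 𝕊¹`. [folklore] -/
theorem fromPath_circleLoop_eq_mapOfEq :
    FundamentalGroup.fromPath (Path.Homotopic.Quotient.mk circleLoop) =
      FundamentalGroup.mapOfEq (addCircleHomeomorph : C(AddCircle (2 * Real.pi), 𝕊 1))
        addCircleHomeomorph_zero
        (FundamentalGroup.fromPath (Path.Homotopic.Quotient.mk (addCircleLoop (2 * Real.pi) 0))) := by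
  rw [FundamentalGroup.mapOfEq_apply]
  change _ = (Path.Homotopic.Quotient.map (Path.Homotopic.Quotient.mk (addCircleLoop (2 * Real.pi) 0))
    (addCircleHomeomorph : C(AddCircle (2 * Real.pi), 𝕊 1))).cast _ _
  rw [← Path.Homotopic.Quotient.mk_map, ← Path.Homotopic.Quotient.mk_cast]
  refine congrArg Path.Homotopic.Quotient.mk (Path.ext (funext fun t => ?_))
  change circlePoint (2 * Real.pi * t) =
    addCircleHomeomorph ((0 : AddCircle (2 * Real.pi)) + (((t : ℝ) * (2 * Real.pi) : ℝ) : AddCircle (2 * Real.pi)))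
  rw [zero_add, addCircleHomeomorph_coe, mul_comm]

/-- **`π₁(𝕊¹)` is generated by the standard loop** (Hatcher (2002), Thm. 1.7), transported from
`ℝ/2πℤ` (`zpowers_addCircleLoop`). [cite: HatcherAT2002, Thm. 1.7] -/
theorem zpowers_fromPath_circleLoop :
    Subgroup.zpowers (FundamentalGroup.fromPath (Path.Homotopic.Quotient.mk circleLoop)) = ⊤ := by
  have h2π : (2 * Real.pi) ≠ 0 := by positivity
  set E := fundamentalGroupEquivOfHomeomorph (addCircleHomeomorph : AddCircle (2 * Real.pi) ≃ₜ 𝕊 1)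
    addCircleHomeomorph_zero with hE
  have hgen : FundamentalGroup.fromPath (Path.Homotopic.Quotient.mk circleLoop) =
      E (FundamentalGroup.fromPath (Path.Homotopic.Quotient.mk (addCircleLoop (2 * Real.pi) 0))) := by
    rw [hE, fundamentalGroupEquivOfHomeomorph_apply]
    exact fromPath_circleLoop_eq_mapOfEq
  rw [hgen, Subgroup.eq_top_iff']
  intro γ
  obtain ⟨δ, rfl⟩ := E.surjective γ
  have hδ : δ ∈ Subgroup.zpowers
      (FundamentalGroup.fromPath (Path.Homotopic.Quotient.mk (addCircleLoop (2 * Real.pi) 0))) := by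
    rw [zpowers_addCircleLoop h2π]; trivial
  obtain ⟨k, rfl⟩ := Subgroup.mem_zpowers_iff.1 hδ
  exact Subgroup.mem_zpowers_iff.2 ⟨k, (map_zpow E _ k).symm⟩

/-- **The standard loop has infinite order in `π₁(𝕊¹)`** (Hatcher (2002), Thm. 1.7).
[cite: HatcherAT2002, Thm. 1.7] -/
theorem fromPath_circleLoop_zpow_eq_one_iff (n : ℤ) :
    FundamentalGroup.fromPath (Path.Homotopic.Quotient.mk circleLoop) ^ n = 1 ↔ n = 0 := by
  have h2π : (2 * Real.pi) ≠ 0 := by positivity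
  set E := fundamentalGroupEquivOfHomeomorph (addCircleHomeomorph : AddCircle (2 * Real.pi) ≃ₜ 𝕊 1)
    addCircleHomeomorph_zero with hE
  have hgen : FundamentalGroup.fromPath (Path.Homotopic.Quotient.mk circleLoop) =
      E (FundamentalGroup.fromPath (Path.Homotopic.Quotient.mk (addCircleLoop (2 * Real.pi) 0))) := by
    rw [hE, fundamentalGroupEquivOfHomeomorph_apply]
    exact fromPath_circleLoop_eq_mapOfEq
  rw [hgen, ← map_zpow, E.map_eq_one_iff]
  exact addCircleLoop_zpow_eq_one_iff h2π 0 n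

/-- **`H₁(𝕊¹; ℤ)` is generated by the Hurewicz class of the standard loop** (Hatcher (2002),
Thm. 2A.1 with Thm. 1.7). [cite: HatcherAT2002, Thm. 2A.1] -/
theorem exists_eq_zsmul_loopClass_circleLoop (x : singularHomology ℤ ℤ (𝕊 1) 1) :
    ∃ k : ℤ, x = k • loopClass ℤ ℤ (1 : ℤ) circleLoop := by
  obtain ⟨g, rfl⟩ := HurewiczProof.hurewiczOne_surjective (circlePoint 0 : 𝕊 1) (Multiplicative.ofAdd x)
    |>.imp fun g hg => (by simpa using congrArg Multiplicative.toAdd hg.symm)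
  have hg : g ∈ Subgroup.zpowers (FundamentalGroup.fromPath (Path.Homotopic.Quotient.mk circleLoop)) := by
    rw [zpowers_fromPath_circleLoop]; trivial
  obtain ⟨k, rfl⟩ := Subgroup.mem_zpowers_iff.1 hg
  refine ⟨k, ?_⟩
  rw [map_zpow, hurewiczOne_fromPath, toAdd_zpow, toAdd_ofAdd]

/-- **The Hurewicz class of the standard loop has infinite order in `H₁(𝕊¹; ℤ)`**
(Hatcher (2002), Thm. 2A.1 with Thm. 1.7: `π₁(𝕊¹)` is abelian, so `h` is injective).
[cite: HatcherAT2002, Thm. 2A.1] -/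
theorem zsmul_loopClass_circleLoop_injective :
    Injective fun k : ℤ => k • loopClass ℤ ℤ (1 : ℤ) circleLoop := by
  intro k l hkl
  have hinj := HurewiczProof.hurewiczOneAb_injective (circlePoint 0 : 𝕊 1)
  have h : (Abelianization.of (FundamentalGroup.fromPath (Path.Homotopic.Quotient.mk circleLoop))) ^ k =
      (Abelianization.of (FundamentalGroup.fromPath (Path.Homotopic.Quotient.mk circleLoop))) ^ l := by
    apply hinj
    rw [map_zpow, map_zpow, hurewiczOneAb_of_fromPath]
    change Multiplicative.ofAdd (k • loopClass ℤ ℤ (1 : ℤ) circleLoop) =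
      Multiplicative.ofAdd (l • loopClass ℤ ℤ (1 : ℤ) circleLoop)
    exact congrArg Multiplicative.ofAdd hkl
  -- `π₁(𝕊¹)` is cyclic, hence abelian: `Abelianization.of` is injective
  have hcomm : ∀ a b : FundamentalGroup (𝕊 1) (circlePoint 0), a * b = b * a := by
    intro a b
    have ha : a ∈ Subgroup.zpowers (FundamentalGroup.fromPath (Path.Homotopic.Quotient.mk circleLoop)) := by
      rw [zpowers_fromPath_circleLoop]; trivial
    have hb : b ∈ Subgroup.zpowers (FundamentalGroup.fromPath (Path.Homotopic.Quotient.mk circleLoop)) := by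
      rw [zpowers_fromPath_circleLoop]; trivial
    obtain ⟨i, rfl⟩ := Subgroup.mem_zpowers_iff.1 ha
    obtain ⟨j, rfl⟩ := Subgroup.mem_zpowers_iff.1 hb
    exact zpow_mul_comm _ i j
  have hker : commutator (FundamentalGroup (𝕊 1) (circlePoint 0)) = ⊥ := by
    rw [commutator_eq_bot_iff_center_eq_top, Subgroup.eq_top_iff']
    intro a
    rw [Subgroup.mem_center_iff]
    intro b
    exact hcomm b a
  have hofinj : Injective (Abelianization.of : FundamentalGroup (𝕊 1) (circlePoint 0) → _) := by
    intro a b hab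
    rw [← QuotientGroup.ker_mk' (commutator (FundamentalGroup (𝕊 1) (circlePoint 0)))] at hker
    have : a⁻¹ * b ∈ (QuotientGroup.mk' (commutator (FundamentalGroup (𝕊 1) (circlePoint 0)))).ker := by
      rw [MonoidHom.mem_ker, map_mul, map_inv]
      change (Abelianization.of a)⁻¹ * Abelianization.of b = 1
      rw [hab, inv_mul_cancel]
    rw [hker, Subgroup.mem_bot] at this
    exact inv_mul_eq_one.1 this
  rw [← map_zpow, ← map_zpow] at h
  have h' := hofinj h
  rw [← sub_eq_zero]
  rw [← (fromPath_circleLoop_zpow_eq_one_iff (k - l)), zpow_sub, h', mul_inv_cancel]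


/-! ### The open solid torus retracts onto its core circle -/

namespace solidTorus

/-- The point `(w, v)` of the open solid torus, for `‖w‖ < 1`. [folklore] -/
def pt (w : 𝔼 2) (hw : ‖w‖ < 1) (v : 𝕊 1) : ↥solidTorus :=
  ⟨(w, v), (mem_solidTorus_iff _).2 hw⟩

/-- Coordinates of `pt`. [folklore] -/
@[simp] theorem coe_pt (w : 𝔼 2) (hw : ‖w‖ < 1) (v : 𝕊 1) : (pt w hw v : (𝔼 2) × (𝕊 1)) = (w, v) := rfl

/-- The projection of the open solid torus `D̊² × 𝕊¹` onto its circle factor. [folklore] -/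
def proj : C(↥solidTorus, 𝕊 1) where
  toFun b := (b : (𝔼 2) × (𝕊 1)).2
  continuous_toFun := continuous_snd.comp continuous_subtype_val

/-- The core circle `{0} × 𝕊¹` of the open solid torus. [folklore] -/
def core : C(𝕊 1, ↥solidTorus) where
  toFun v := pt 0 (by simp) v
  continuous_toFun := (continuous_const.prodMk continuous_id).subtype_mk _

/-- Value of `proj`. [folklore] -/
@[simp] theorem proj_apply (b : ↥solidTorus) : proj b = (b : (𝔼 2) × (𝕊 1)).2 := rfl

/-- Value of `core`. [folklore] -/
@[simp] theorem coe_core_apply (v : 𝕊 1) : (core v : (𝔼 2) × (𝕊 1)) = (0, v) := rfl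

/-- The straight-line homotopy `(t, (w, v)) ↦ (t w, v)` from `core ∘ proj` to the identity of the
open solid torus (the disc factor is convex). [folklore] -/
def coreProjHomotopy : ContinuousMap.Homotopy (core.comp proj) (ContinuousMap.id ↥solidTorus) where
  toFun p := ⟨(((p.1 : ℝ)) • (p.2 : (𝔼 2) × (𝕊 1)).1, (p.2 : (𝔼 2) × (𝕊 1)).2), by
    rw [mem_solidTorus_iff, norm_smul, Real.norm_eq_abs, abs_of_nonneg p.1.2.1]
    exact (mul_le_of_le_one_left (norm_nonneg _) p.1.2.2).trans_lt ((mem_solidTorus_iff _).1 p.2.2)⟩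
  continuous_toFun := by
    refine Continuous.subtype_mk (Continuous.prodMk ?_ ?_) _
    · exact (continuous_subtype_val.comp continuous_fst).smul
        (continuous_fst.comp (continuous_subtype_val.comp continuous_snd))
    · exact continuous_snd.comp (continuous_subtype_val.comp continuous_snd)
  map_zero_left b := by
    apply Subtype.ext
    simp only [Set.Icc.coe_zero, zero_smul, ContinuousMap.comp_apply]
    rfl
  map_one_left b := by
    apply Subtype.ext
    simp only [Set.Icc.coe_one, one_smul, ContinuousMap.id_apply]

/-- `proj ∘ core = id`. [folklore] -/
theorem proj_comp_core : proj.comp core = ContinuousMap.id (𝕊 1) := by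
  ext v; rfl

/-- **`D̊² × 𝕊¹ ≃ 𝕊¹`**: the projection of the open solid torus onto its circle factor is a
homotopy equivalence with homotopy inverse the core circle. [folklore] -/
def homotopyEquiv : ContinuousMap.HomotopyEquiv ↥solidTorus (𝕊 1) where
  toFun := proj
  invFun := core
  left_inv := ⟨coreProjHomotopy⟩
  right_inv := by rw [proj_comp_core]

/-- The open solid torus is path connected. [folklore] -/
instance instPathConnectedSpace : PathConnectedSpace ↥solidTorus := by
  have h : ((solidTorus : TopologicalSpace.Opens ((𝔼 2) × (𝕊 1))) : Set ((𝔼 2) × (𝕊 1))) =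
      ball (0 : 𝔼 2) 1 ×ˢ univ := rfl
  have hp : IsPathConnected
      ((solidTorus : TopologicalSpace.Opens ((𝔼 2) × (𝕊 1))) : Set ((𝔼 2) × (𝕊 1))) := by
    rw [h]
    exact ((convex_ball (0 : 𝔼 2) 1).isPathConnected ⟨0, by simp⟩).prod isPathConnected_univ
  exact isPathConnected_iff_pathConnectedSpace.mp hp

/-- The **longitudinal loop** `t ↦ (w, e^{2πit})` of the open solid torus through the point
`(w, (1, 0))`, parallel to the core circle. [folklore] -/
def loop (w : 𝔼 2) (hw : ‖w‖ < 1) : Path (pt w hw (circlePoint 0)) (pt w hw (circlePoint 0)) where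
  toFun t := pt w hw (circlePoint (2 * Real.pi * t))
  continuous_toFun := (continuous_const.prodMk (continuous_circlePoint.comp (by fun_prop))).subtype_mk _
  source' := by simp only [Set.Icc.coe_zero, circlePoint_two_pi_mul_zero]
  target' := by simp only [Set.Icc.coe_one, circlePoint_two_pi_mul_one]

/-- Value of `loop`. [folklore] -/
@[simp] theorem loop_apply (w : 𝔼 2) (hw : ‖w‖ < 1) (t : unitInterval) :
    loop w hw t = pt w hw (circlePoint (2 * Real.pi * t)) := rfl

/-- Under the projection, the longitudinal loop becomes the standard loop of the circle.
[folklore] -/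
theorem map_proj_loopClass_loop (w : 𝔼 2) (hw : ‖w‖ < 1) :
    singularHomology.map ℤ ℤ proj 1 (loopClass ℤ ℤ (1 : ℤ) (loop w hw)) =
      loopClass ℤ ℤ (1 : ℤ) circleLoop := by
  rw [map_loopClass]
  exact loopClass_eq_of_ofPath_eq ℤ ℤ 1 _ _ rfl

/-- The projection is injective on `H₁` (it is a homotopy equivalence). [folklore] -/
theorem map_proj_one_injective : Injective (singularHomology.map ℤ ℤ proj 1) :=
  (ModuleCat.mono_iff_injective _).1
    (inferInstanceAs (Mono (singularHomology.isoOfHomotopyEquiv ℤ ℤ homotopyEquiv 1).hom))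

/-- **`H₁(D̊² × 𝕊¹; ℤ)` is generated by the longitudinal loop** through any point. [folklore] -/
theorem exists_eq_zsmul_loopClass_loop (w : 𝔼 2) (hw : ‖w‖ < 1)
    (x : singularHomology ℤ ℤ ↥solidTorus 1) :
    ∃ k : ℤ, x = k • loopClass ℤ ℤ (1 : ℤ) (loop w hw) := by
  obtain ⟨k, hk⟩ := exists_eq_zsmul_loopClass_circleLoop (singularHomology.map ℤ ℤ proj 1 x)
  refine ⟨k, map_proj_one_injective ?_⟩
  rw [hk, map_zsmul, map_proj_loopClass_loop]

/-- **The longitudinal loop has infinite order in `H₁(D̊² × 𝕊¹; ℤ)`.** [folklore] -/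
theorem zsmul_loopClass_loop_injective (w : 𝔼 2) (hw : ‖w‖ < 1) :
    Injective fun k : ℤ => k • loopClass ℤ ℤ (1 : ℤ) (loop w hw) := by
  intro k l hkl
  apply zsmul_loopClass_circleLoop_injective
  have h := congrArg (singularHomology.map ℤ ℤ proj 1) hkl
  simpa only [map_zsmul, map_proj_loopClass_loop] using h

/-- A loop of the open solid torus whose circle coordinate is constant (e.g. a meridian circle
`t ↦ (r e^{2πit}, v₀)`) has trivial Hurewicz class. [folklore] -/
theorem loopClass_eq_zero_of_proj_eq {b : ↥solidTorus} (γ : Path b b)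
    (hγ : ∀ t, (γ t : (𝔼 2) × (𝕊 1)).2 = (b : (𝔼 2) × (𝕊 1)).2) :
    loopClass ℤ ℤ (1 : ℤ) γ = 0 := by
  apply map_proj_one_injective
  rw [map_loopClass, map_zero]
  have h : γ.map proj.continuous = Path.refl (proj b) :=
    Path.ext (funext fun t => hγ t)
  rw [h, loopClass_refl]

/-- **`H₂(D̊² × 𝕊¹; ℤ) = 0`** (homotopy equivalent to the circle). [folklore] -/
theorem isZero_singularHomology_two : IsZero (singularHomology ℤ ℤ ↥solidTorus 2) :=
  (isZero_singularHomology_sphere_holds ℤ ℤ (n := 1) (k := 2) two_ne_zero (by decide)).of_iso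
    (singularHomology.isoOfHomotopyEquiv ℤ ℤ homotopyEquiv 2)

end solidTorus


/-! ### The punctured disc -/

namespace puncturedDisc

/-- The punctured open unit disc is path connected: it is the image of `(0, 1) × 𝕊¹` under
`(t, u) ↦ t u`. [folklore] -/
instance instPathConnectedSpace : PathConnectedSpace ↥puncturedDisc := by
  have h : IsPathConnected (puncturedDisc : Set (𝔼 2)) := by
    have him : (fun p : ℝ × (𝕊 1) => p.1 • (p.2 : 𝔼 2)) '' (Ioo (0 : ℝ) 1 ×ˢ univ) = puncturedDisc := by
      ext z
      simp only [mem_image, mem_prod, mem_Ioo, mem_univ, and_true, Prod.exists]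
      constructor
      · rintro ⟨t, u, ⟨ht0, ht1⟩, rfl⟩
        refine ⟨smul_ne_zero ht0.ne' (ne_zero_of_mem_unit_sphere u), ?_⟩
        rw [norm_smul, norm_eq_of_mem_sphere, mul_one, Real.norm_of_nonneg ht0.le]
        exact ht1
      · rintro ⟨hz0, hz1⟩
        have hn : 0 < ‖z‖ := norm_pos_iff.2 hz0
        refine ⟨‖z‖, ⟨‖z‖⁻¹ • z, by simp [norm_smul, inv_mul_cancel₀ hn.ne']⟩, ⟨hn, hz1⟩, ?_⟩
        rw [smul_inv_smul₀ hn.ne']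
    rw [← him]
    exact (((convex_Ioo (0 : ℝ) 1).isPathConnected ⟨2⁻¹, by norm_num⟩).prod
      isPathConnected_univ).image
      (show Continuous fun p : ℝ × (𝕊 1) => p.1 • (p.2 : 𝔼 2) by fun_prop)
  exact isPathConnected_iff_pathConnectedSpace.mp h

/-- The **winding loop** `t ↦ ½ e^{2πit}` of the punctured disc (the standard loop of the circle
pushed in along `half`). [folklore] -/
abbrev loop : Path (half (circlePoint 0)) (half (circlePoint 0)) := circleLoop.map half.continuous

/-- Under the radial projection the winding loop becomes the standard loop (pointwise).
[folklore] -/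
theorem loop_map_radial_apply (t : unitInterval) : loop.map radial.continuous t = circleLoop t := by
  change (radial.comp half) (circleLoop t) = circleLoop t
  rw [radial_comp_half]
  rfl

/-- Under the radial projection the Hurewicz class of the winding loop becomes that of the
standard loop. [folklore] -/
theorem map_radial_loopClass_loop :
    singularHomology.map ℤ ℤ radial 1 (loopClass ℤ ℤ (1 : ℤ) loop) = loopClass ℤ ℤ (1 : ℤ) circleLoop := by
  rw [map_loopClass]
  exact loopClass_congr_fun loop_map_radial_apply

/-- The radial projection is injective on `H₁` (it is a homotopy equivalence). [folklore] -/
theorem map_radial_one_injective : Injective (singularHomology.map ℤ ℤ radial 1) :=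
  (ModuleCat.mono_iff_injective _).1
    (inferInstanceAs (Mono (singularHomology.isoOfHomotopyEquiv ℤ ℤ homotopyEquiv 1).hom))

/-- **`H₁(D̊² ∖ 0; ℤ)` is generated by the winding loop.** [folklore] -/
theorem exists_eq_zsmul_loopClass_loop (x : singularHomology ℤ ℤ ↥puncturedDisc 1) :
    ∃ k : ℤ, x = k • loopClass ℤ ℤ (1 : ℤ) loop := by
  obtain ⟨k, hk⟩ := exists_eq_zsmul_loopClass_circleLoop (singularHomology.map ℤ ℤ radial 1 x)
  refine ⟨k, map_radial_one_injective ?_⟩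
  rw [hk, map_zsmul, map_radial_loopClass_loop]

end puncturedDisc

/-! ### The model `𝕊¹ × (D̊² ∖ 0)` of the gluing region -/

namespace surgeryModel

/-- The base point `((1, 0), (½, 0))` of the model `𝕊¹ × (D̊² ∖ 0)`. [folklore] -/
abbrev base : (𝕊 1) × ↥puncturedDisc := (circlePoint 0, puncturedDisc.half (circlePoint 0))

/-- The **longitudinal loop** `t ↦ (e^{2πit}, ½)` of the model (knot direction). [folklore] -/
abbrev lonLoop : Path base base := circleLoop.prod (Path.refl (puncturedDisc.half (circlePoint 0)))

/-- The **meridional loop** `t ↦ (1, ½ e^{2πit})` of the model (around the puncture). [folklore] -/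
abbrev merLoop : Path base base := (Path.refl (circlePoint 0)).prod puncturedDisc.loop

/-- Pushing the standard loop into the model along `u ↦ (u, ½)` gives the longitudinal loop.
[folklore] -/
theorem map_inl_loopClass_circleLoop :
    singularHomology.map ℤ ℤ ((ContinuousMap.id (𝕊 1)).prodMk
        (ContinuousMap.const (𝕊 1) (puncturedDisc.half (circlePoint 0)))) 1
      (loopClass ℤ ℤ (1 : ℤ) circleLoop) = loopClass ℤ ℤ (1 : ℤ) lonLoop := by
  rw [map_loopClass]
  exact loopClass_congr_fun fun t => rfl

/-- Pushing the winding loop of the punctured disc into the model along `w ↦ ((1, 0), w)` gives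
the meridional loop. [folklore] -/
theorem map_inr_loopClass_loop :
    singularHomology.map ℤ ℤ ((ContinuousMap.const ↥puncturedDisc (circlePoint 0 : 𝕊 1)).prodMk
        (ContinuousMap.id ↥puncturedDisc)) 1
      (loopClass ℤ ℤ (1 : ℤ) puncturedDisc.loop) = loopClass ℤ ℤ (1 : ℤ) merLoop := by
  rw [map_loopClass]
  exact loopClass_congr_fun fun t => rfl

/-- **`H₁(𝕊¹ × (D̊² ∖ 0); ℤ)` is generated by the longitudinal and the meridional loop**
(degree-one Künneth, Hatcher (2002), Thm. 3B.6, from `singularHomology.map_inl_fst_add_map_inr_snd_one`).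
[cite: HatcherAT2002, Thm. 3B.6] -/
theorem exists_eq_zsmul_add_zsmul (z : singularHomology ℤ ℤ ((𝕊 1) × ↥puncturedDisc) 1) :
    ∃ i j : ℤ, z = i • loopClass ℤ ℤ (1 : ℤ) lonLoop + j • loopClass ℤ ℤ (1 : ℤ) merLoop := by
  obtain ⟨i, hi⟩ := exists_eq_zsmul_loopClass_circleLoop
    (singularHomology.map ℤ ℤ (ContinuousMap.fst : C((𝕊 1) × ↥puncturedDisc, 𝕊 1)) 1 z)
  obtain ⟨j, hj⟩ := puncturedDisc.exists_eq_zsmul_loopClass_loop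
    (singularHomology.map ℤ ℤ (ContinuousMap.snd : C((𝕊 1) × ↥puncturedDisc, ↥puncturedDisc)) 1 z)
  refine ⟨i, j, ?_⟩
  have key := congrArg (fun f => (ModuleCat.Hom.hom f) z)
    (singularHomology.map_inl_fst_add_map_inr_snd_one (circlePoint 0 : 𝕊 1)
      (puncturedDisc.half (circlePoint 0)))
  simp only [ModuleCat.hom_add, LinearMap.add_apply, ModuleCat.hom_comp, LinearMap.comp_apply,
    ModuleCat.hom_id, LinearMap.id_apply] at key
  rw [← key]
  change singularHomology.map ℤ ℤ _ 1 (singularHomology.map ℤ ℤ ContinuousMap.fst 1 z) +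
    singularHomology.map ℤ ℤ _ 1 (singularHomology.map ℤ ℤ ContinuousMap.snd 1 z) = _
  rw [hi, hj, map_zsmul, map_zsmul, map_inl_loopClass_circleLoop, map_inr_loopClass_loop]

/-- The longitudinal loop projects to the standard loop of the knot-direction circle. [folklore] -/
theorem map_fst_loopClass_lonLoop :
    singularHomology.map ℤ ℤ (ContinuousMap.fst : C((𝕊 1) × ↥puncturedDisc, 𝕊 1)) 1
      (loopClass ℤ ℤ (1 : ℤ) lonLoop) = loopClass ℤ ℤ (1 : ℤ) circleLoop := by
  rw [map_loopClass]
  exact loopClass_congr_fun fun t => rfl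

/-- The meridional loop projects to a constant loop of the knot-direction circle. [folklore] -/
theorem map_fst_loopClass_merLoop :
    singularHomology.map ℤ ℤ (ContinuousMap.fst : C((𝕊 1) × ↥puncturedDisc, 𝕊 1)) 1
      (loopClass ℤ ℤ (1 : ℤ) merLoop) = 0 := by
  rw [map_loopClass, ← loopClass_refl ℤ ℤ (1 : ℤ) (circlePoint 0 : 𝕊 1)]
  exact loopClass_congr_fun fun t => rfl

/-- **The longitudinal loop has infinite order in `H₁` of the model**, even modulo the
meridional loop: `i • [lon] + j • [mer] = 0` forces `i = 0`. [folklore] -/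
theorem eq_zero_of_zsmul_add_zsmul_eq_zero {i j : ℤ}
    (h : i • loopClass ℤ ℤ (1 : ℤ) lonLoop + j • loopClass ℤ ℤ (1 : ℤ) merLoop = 0) : i = 0 := by
  have h' := congrArg (singularHomology.map ℤ ℤ
    (ContinuousMap.fst : C((𝕊 1) × ↥puncturedDisc, 𝕊 1)) 1) h
  rw [map_add, map_zsmul, map_zsmul, map_fst_loopClass_lonLoop, map_fst_loopClass_merLoop,
    zsmul_zero, add_zero, map_zero] at h'
  exact zsmul_loopClass_circleLoop_injective (h'.trans (zero_zsmul _).symm)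

end surgeryModel


/-! ### `H₁` of the knot complement in terms of Hurewicz classes -/

namespace Knot.TubularNbhd

variable {K : Knot} (ν : Knot.TubularNbhd K)

/-- **`H₁(S³ ∖ K; ℤ)` is generated by the Hurewicz class of the meridian** (Crowell–Fox,
Ch. VIII (1.1)–(1.2); the tree's `bijective_zpowersHom_abelianizationOf_meridian` read through
the Hurewicz isomorphism `hurewiczOneAb`, Hatcher Thm. 2A.1). [cite: CrowellFox1963, Ch. VIII (1.2)] -/
theorem exists_eq_zsmul_loopClass_meridian (x : singularHomology ℤ ℤ ↥K.complement 1) :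
    ∃ k : ℤ, x = k • loopClass ℤ ℤ (1 : ℤ) ν.meridian := by
  haveI : Knot.ComplementFacts := Knot.complementFacts_holds
  obtain ⟨g, hg⟩ := HurewiczProof.hurewiczOneAb_surjective ν.basePoint (Multiplicative.ofAdd x)
  obtain ⟨k, rfl⟩ := ν.bijective_zpowersHom_abelianizationOf_meridian.2 g
  refine ⟨Multiplicative.toAdd k, ?_⟩
  rw [zpowersHom_apply, map_zpow, hurewiczOneAb_of_fromPath] at hg
  have := congrArg Multiplicative.toAdd hg
  rw [toAdd_zpow, toAdd_ofAdd, toAdd_ofAdd] at this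
  exact this.symm

/-- **The Hurewicz class of the meridian has infinite order in `H₁(S³ ∖ K; ℤ)`.**
[cite: CrowellFox1963, Ch. VIII (1.2)] -/
theorem zsmul_loopClass_meridian_injective :
    Injective fun k : ℤ => k • loopClass ℤ ℤ (1 : ℤ) ν.meridian := by
  haveI : Knot.ComplementFacts := Knot.complementFacts_holds
  intro k l hkl
  have hinj := HurewiczProof.hurewiczOneAb_injective ν.basePoint
  have h := ν.bijective_zpowersHom_abelianizationOf_meridian.1
    (a₁ := Multiplicative.ofAdd k) (a₂ := Multiplicative.ofAdd l) (hinj ?_)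
  · simpa using h
  · rw [zpowersHom_apply, zpowersHom_apply, map_zpow, map_zpow, hurewiczOneAb_of_fromPath,
      toAdd_ofAdd, toAdd_ofAdd]
    change Multiplicative.ofAdd (k • loopClass ℤ ℤ (1 : ℤ) ν.meridian) =
      Multiplicative.ofAdd (l • loopClass ℤ ℤ (1 : ℤ) ν.meridian)
    exact congrArg Multiplicative.ofAdd hkl

end Knot.TubularNbhd

namespace surgeryModel

variable {K : Knot} (ν : Knot.TubularNbhd K)

/-- The model map of the gluing region into the knot complement: `(u, w) ↦ ν (u, w)`,
`0 < ‖w‖ < 1`. [folklore] -/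
def toComplement : C((𝕊 1) × ↥puncturedDisc, ↥K.complement) where
  toFun p := ⟨ν (p.1, (p.2 : 𝔼 2)), ν.apply_mem_compl_range p.2.2.1⟩
  continuous_toFun := (ν.continuous.comp (continuous_fst.prodMk
    (continuous_subtype_val.comp continuous_snd))).subtype_mk _

/-- Value of `toComplement`. [folklore] -/
@[simp] theorem coe_toComplement_apply (p : (𝕊 1) × ↥puncturedDisc) :
    (toComplement ν p : 𝕊 3) = ν (p.1, (p.2 : 𝔼 2)) := rfl

/-- Norm of `‖w‖ u` for a unit vector `u`. [folklore] -/
theorem norm_norm_smul_coe (u : 𝕊 1) (w : 𝔼 2) : ‖‖w‖ • (u : 𝔼 2)‖ = ‖w‖ := by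
  rw [norm_smul, norm_norm, norm_eq_of_mem_sphere, mul_one]

/-- The model map of the gluing region into the open solid torus: `(u, w) ↦ (‖w‖ u, w / ‖w‖)`
(the swap of the polar coordinates of `surgeryRel`). [folklore] -/
def toSolidTorus : C((𝕊 1) × ↥puncturedDisc, ↥solidTorus) where
  toFun p := solidTorus.pt (‖(p.2 : 𝔼 2)‖ • (p.1 : 𝔼 2))
    (by rw [norm_norm_smul_coe]; exact p.2.2.2) (puncturedDisc.radial p.2)
  continuous_toFun := by
    refine Continuous.subtype_mk (Continuous.prodMk ?_ (puncturedDisc.radial.continuous.comp continuous_snd)) _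
    exact ((continuous_subtype_val.comp continuous_snd).norm).smul
      (continuous_subtype_val.comp continuous_fst)

/-- Value of `toSolidTorus`. [folklore] -/
@[simp] theorem coe_toSolidTorus_apply (p : (𝕊 1) × ↥puncturedDisc) :
    (toSolidTorus p : (𝔼 2) × (𝕊 1)) = (‖(p.2 : 𝔼 2)‖ • (p.1 : 𝔼 2), puncturedDisc.radial p.2) := rfl

end surgeryModel

/-! ### The topological datum of an integral surgery -/

/-- **The topological datum of an integral Dehn surgery** on the knot `K` with result `Y`: an
oriented tubular neighbourhood `ν` of `K` and open topological embeddings of the knot complement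
`S³ ∖ K` and of the open solid torus `D̊² × 𝕊¹` into `Y`, jointly onto, glued along the surgery
relation `surgeryRel ν` (the body of `Literature.Topology.FourManifolds.IsIntegralSurgery`,
Rolfsen (1976), §9.F, with the smoothness of the two embeddings forgotten). [cite: Rolfsen1976, §9.F] -/
structure DehnSurgeryDatum (K : Knot) (Y : Type*) [TopologicalSpace Y] where
  /-- The tubular neighbourhood of the knot. -/
  ν : Knot.TubularNbhd K
  /-- The embedding of the knot complement. -/
  jA : ↥K.complement → Y
  /-- The embedding of the open solid torus. -/
  jB : ↥solidTorus → Y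
  /-- `jA` is an embedding. -/
  hA : IsEmbedding jA
  /-- `jA` has open range. -/
  hAo : IsOpen (range jA)
  /-- `jB` is an embedding. -/
  hB : IsEmbedding jB
  /-- `jB` has open range. -/
  hBo : IsOpen (range jB)
  /-- The two pieces cover `Y`. -/
  hcov : range jA ∪ range jB = univ
  /-- The pieces are identified exactly along the surgery relation. -/
  hrel : ∀ a b, jA a = jB b ↔ surgeryRel ν a b

section Datum

variable {EY HY : Type*} [NormedAddCommGroup EY] [NormedSpace ℝ EY] [TopologicalSpace HY]
  {IY : ModelWithCorners ℝ EY HY} {Y : Type*} [TopologicalSpace Y] [ChartedSpace HY Y]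

/-- An integral surgery presentation yields a surgery datum with the same framing. [folklore] -/
theorem IsIntegralSurgery.exists_dehnSurgeryDatum {K : Knot} {m : ℤ} (h : IsIntegralSurgery IY Y K m) :
    ∃ G : DehnSurgeryDatum K Y, G.ν.HasFraming m := by
  obtain ⟨ν, hν, jA, jB, hA, hAo, hB, hBo, hcov, hrel⟩ := h
  exact ⟨⟨ν, jA, jB, hA.isEmbedding, hAo, hB.isEmbedding, hBo, hcov, hrel⟩, hν⟩

end Datum

namespace DehnSurgeryDatum

variable {K : Knot} {Y : Type*} [TopologicalSpace Y] (G : DehnSurgeryDatum K Y)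

/-- The piece `U = jA(S³ ∖ K)`. [folklore] -/
abbrev U : Set Y := range G.jA

/-- The piece `V = jB(D̊² × 𝕊¹)`. [folklore] -/
abbrev V : Set Y := range G.jB

/-- `Y = U ∪ V` is an open cover. [folklore] -/
theorem interior_U_union_interior_V : interior G.U ∪ interior G.V = univ := by
  rw [G.hAo.interior_eq, G.hBo.interior_eq, G.hcov]

/-- **The two model maps are glued**: `jA (ν (u, w)) = jB (‖w‖ u, w / ‖w‖)`. [folklore] -/
theorem jA_toComplement (p : (𝕊 1) × ↥puncturedDisc) :
    G.jA ((surgeryModel.toComplement G.ν) p) = G.jB (surgeryModel.toSolidTorus p) := by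
  rw [G.hrel]
  refine ⟨p.1, ‖(p.2 : 𝔼 2)‖, ⟨norm_pos_iff.2 p.2.2.1, p.2.2.2⟩, rfl, ?_⟩
  change G.ν (p.1, (p.2 : 𝔼 2)) = G.ν (p.1, ‖(p.2 : 𝔼 2)‖ • ((puncturedDisc.radial p.2 : 𝕊 1) : 𝔼 2))
  rw [puncturedDisc.coe_radial_apply, smul_inv_smul₀ (norm_ne_zero_iff.2 p.2.2.1)]

/-- A point of `Y` lies in both pieces iff it is in the image of the model. [folklore] -/
theorem range_jA_inter_range_jB : G.U ∩ G.V = range (fun p => G.jA ((surgeryModel.toComplement G.ν) p)) := by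
  apply Subset.antisymm
  · rintro y ⟨⟨a, rfl⟩, ⟨b, hb⟩⟩
    obtain ⟨u, t, ht, hb1, ha⟩ := (G.hrel a b).1 hb.symm
    have hw : t • ((b : (𝔼 2) × (𝕊 1)).2 : 𝔼 2) ∈ puncturedDisc := by
      refine ⟨smul_ne_zero ht.1.ne' (ne_zero_of_mem_unit_sphere _), ?_⟩
      rw [norm_smul, norm_eq_of_mem_sphere, mul_one, Real.norm_of_nonneg ht.1.le]
      exact ht.2
    refine ⟨(u, ⟨_, hw⟩), congrArg G.jA (Subtype.ext ?_)⟩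
    exact ha.symm
  · rintro _ ⟨p, rfl⟩
    exact ⟨⟨_, rfl⟩, ⟨_, (G.jA_toComplement p).symm⟩⟩

/-- The model map `𝕊¹ × (D̊² ∖ 0) → Y` is an embedding. [folklore] -/
theorem isEmbedding_jA_toComplement : IsEmbedding (fun p => G.jA ((surgeryModel.toComplement G.ν) p)) := by
  refine G.hA.comp ?_
  have h : IsEmbedding (fun p : (𝕊 1) × ↥puncturedDisc => G.ν (p.1, (p.2 : 𝔼 2))) :=
    G.ν.isSmoothEmbedding.isEmbedding.comp (IsEmbedding.id.prodMap IsEmbedding.subtypeVal)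
  exact h.codRestrict _ _

/-- `S³ ∖ K ≃ₜ U` via `jA`. [folklore] -/
def homeomorphU : ↥K.complement ≃ₜ ↥G.U := G.hA.toHomeomorph

/-- `D̊² × 𝕊¹ ≃ₜ V` via `jB`. [folklore] -/
def homeomorphV : ↥solidTorus ≃ₜ ↥G.V := G.hB.toHomeomorph

/-- `𝕊¹ × (D̊² ∖ 0) ≃ₜ U ∩ V` via `(u, w) ↦ jA (ν (u, w))`. [folklore] -/
def homeomorphW : (𝕊 1) × ↥puncturedDisc ≃ₜ ↥(G.U ∩ G.V) :=
  G.isEmbedding_jA_toComplement.toHomeomorph.trans (Homeomorph.setCongr G.range_jA_inter_range_jB.symm)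

/-- Value of `homeomorphU`. [folklore] -/
@[simp] theorem coe_homeomorphU_apply (a : ↥K.complement) : (G.homeomorphU a : Y) = G.jA a := rfl
/-- Value of `homeomorphV`. [folklore] -/
@[simp] theorem coe_homeomorphV_apply (b : ↥solidTorus) : (G.homeomorphV b : Y) = G.jB b := rfl
/-- Value of `homeomorphW`. [folklore] -/
@[simp] theorem coe_homeomorphW_apply (p : (𝕊 1) × ↥puncturedDisc) :
    (G.homeomorphW p : Y) = G.jA ((surgeryModel.toComplement G.ν) p) := rfl

/-- The inclusion `U ∩ V ↪ U` is conjugate to the model map `toComplement`. [folklore] -/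
theorem subsetInclusion_left_homeomorphW (p : (𝕊 1) × ↥puncturedDisc) :
    subsetInclusion (inter_subset_left : G.U ∩ G.V ⊆ G.U) (G.homeomorphW p) =
      G.homeomorphU ((surgeryModel.toComplement G.ν) p) := rfl

/-- The inclusion `U ∩ V ↪ V` is conjugate to the model map `toSolidTorus`. [folklore] -/
theorem subsetInclusion_right_homeomorphW (p : (𝕊 1) × ↥puncturedDisc) :
    subsetInclusion (inter_subset_right : G.U ∩ G.V ⊆ G.V) (G.homeomorphW p) =
      G.homeomorphV (surgeryModel.toSolidTorus p) :=
  Subtype.ext (G.jA_toComplement p)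

/-- `U ∩ V` is path connected. [folklore] -/
instance instPathConnectedSpaceInter : PathConnectedSpace ↥(G.U ∩ G.V) :=
  G.homeomorphW.surjective.pathConnectedSpace G.homeomorphW.continuous

/-! ### The loops of the gluing region in the two pieces -/

/-- In the knot complement, the longitudinal loop of the model is the longitude of `ν`.
[folklore] -/
theorem loopClass_lonLoop_map_toComplement :
    loopClass ℤ ℤ (1 : ℤ) (surgeryModel.lonLoop.map (surgeryModel.toComplement G.ν).continuous) =
      loopClass ℤ ℤ (1 : ℤ) G.ν.longitude := by
  refine loopClass_congr_fun fun t => Subtype.ext ?_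
  simp only [Path.map_coe, Function.comp_apply, surgeryModel.coe_toComplement_apply,
    Knot.TubularNbhd.coe_longitude_apply, framingBaseVector, one_div]
  rfl

/-- In the knot complement, the meridional loop of the model is the meridian of `ν`. [folklore] -/
theorem loopClass_merLoop_map_toComplement :
    loopClass ℤ ℤ (1 : ℤ) (surgeryModel.merLoop.map (surgeryModel.toComplement G.ν).continuous) =
      loopClass ℤ ℤ (1 : ℤ) G.ν.meridian := by
  refine loopClass_congr_fun fun t => Subtype.ext ?_
  simp only [Path.map_coe, Function.comp_apply, surgeryModel.coe_toComplement_apply,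
    Knot.TubularNbhd.coe_meridian_apply, one_div]
  rfl

/-- Norm of `half u`. [folklore] -/
theorem norm_coe_half (u : 𝕊 1) : ‖((puncturedDisc.half u : ↥puncturedDisc) : 𝔼 2)‖ = 2⁻¹ := by
  rw [puncturedDisc.coe_half_apply, norm_smul, norm_eq_of_mem_sphere, mul_one,
    Real.norm_of_nonneg (by norm_num)]

/-- `‖u/2‖ < 1` for a unit vector `u`. [folklore] -/
theorem norm_half_smul_lt (u : 𝕊 1) : ‖(2⁻¹ : ℝ) • (u : 𝔼 2)‖ < 1 := by
  rw [norm_smul, norm_eq_of_mem_sphere, mul_one, Real.norm_of_nonneg (by norm_num)]; norm_num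

/-- `radial (half u) = u`. [folklore] -/
theorem radial_half (u : 𝕊 1) : puncturedDisc.radial (puncturedDisc.half u) = u :=
  congrArg (fun f : C(𝕊 1, 𝕊 1) => f u) puncturedDisc.radial_comp_half

/-- In the solid torus, the longitudinal loop of the model is a meridian circle
`t ↦ (½ e^{2πit}, (1, 0))`, null-homologous. [folklore] -/
theorem loopClass_lonLoop_map_toSolidTorus :
    loopClass ℤ ℤ (1 : ℤ) (surgeryModel.lonLoop.map surgeryModel.toSolidTorus.continuous) = 0 := by
  refine solidTorus.loopClass_eq_zero_of_proj_eq _ fun t => ?_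
  simp only [Path.map_coe, Function.comp_apply, surgeryModel.coe_toSolidTorus_apply]
  rfl

/-- In the solid torus, the meridional loop of the model is the longitudinal loop
`t ↦ ((½, 0), e^{2πit})` through `(½, 0)`. [folklore] -/
theorem loopClass_merLoop_map_toSolidTorus :
    loopClass ℤ ℤ (1 : ℤ) (surgeryModel.merLoop.map surgeryModel.toSolidTorus.continuous) =
      loopClass ℤ ℤ (1 : ℤ) (solidTorus.loop ((2⁻¹ : ℝ) • ((circlePoint 0 : 𝕊 1) : 𝔼 2))
        (norm_half_smul_lt _)) := by
  refine loopClass_congr_fun fun t => Subtype.ext ?_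
  simp only [Path.map_coe, Function.comp_apply, surgeryModel.coe_toSolidTorus_apply, solidTorus.loop_apply,
    solidTorus.coe_pt]
  refine Prod.ext ?_ ?_
  · change ‖((puncturedDisc.half _ : ↥puncturedDisc) : 𝔼 2)‖ • ((circlePoint 0 : 𝕊 1) : 𝔼 2) = _
    rw [norm_coe_half]
  · exact radial_half _

/-! ### Mayer–Vietoris for `Y = U ∪ V`: generators -/

section Homology

variable {K : Knot} {Y : Type} [TopologicalSpace Y] (G : DehnSurgeryDatum K Y)

/-- The generator `gU = (jA)_* h(μ)` of `H₁(U; ℤ)`: the meridian of the knot. [folklore] -/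
def gU : singularHomology ℤ ℤ ↥G.U 1 :=
  singularHomology.map ℤ ℤ (G.homeomorphU : C(↥K.complement, ↥G.U)) 1
    (loopClass ℤ ℤ (1 : ℤ) G.ν.meridian)

/-- The generator `gV = (jB)_* h(ℓ)` of `H₁(V; ℤ)`: the longitudinal loop of the new solid torus
through `((½, 0), (1, 0))`. [folklore] -/
def gV : singularHomology ℤ ℤ ↥G.V 1 :=
  singularHomology.map ℤ ℤ (G.homeomorphV : C(↥solidTorus, ↥G.V)) 1
    (loopClass ℤ ℤ (1 : ℤ) (solidTorus.loop ((2⁻¹ : ℝ) • ((circlePoint 0 : 𝕊 1) : 𝔼 2))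
      (norm_half_smul_lt _)))

/-- The class `A` of the longitudinal loop of the gluing region `U ∩ V`. [folklore] -/
def genA : singularHomology ℤ ℤ ↥(G.U ∩ G.V) 1 :=
  singularHomology.map ℤ ℤ (G.homeomorphW : C((𝕊 1) × ↥puncturedDisc, ↥(G.U ∩ G.V))) 1
    (loopClass ℤ ℤ (1 : ℤ) surgeryModel.lonLoop)

/-- The class `B` of the meridional loop of the gluing region `U ∩ V`. [folklore] -/
def genB : singularHomology ℤ ℤ ↥(G.U ∩ G.V) 1 :=
  singularHomology.map ℤ ℤ (G.homeomorphW : C((𝕊 1) × ↥puncturedDisc, ↥(G.U ∩ G.V))) 1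
    (loopClass ℤ ℤ (1 : ℤ) surgeryModel.merLoop)

/-- **`H₁(U; ℤ) = ℤ gU`.** [folklore] -/
theorem exists_eq_zsmul_gU (x : singularHomology ℤ ℤ ↥G.U 1) : ∃ k : ℤ, x = k • G.gU := by
  obtain ⟨x, rfl⟩ := singularHomology_map_homeomorph_surjective G.homeomorphU 1 x
  obtain ⟨k, rfl⟩ := G.ν.exists_eq_zsmul_loopClass_meridian x
  exact ⟨k, by rw [map_zsmul]; rfl⟩

/-- **`gU` has infinite order.** [folklore] -/
theorem zsmul_gU_injective : Injective fun k : ℤ => k • G.gU := by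
  intro k l hkl
  apply G.ν.zsmul_loopClass_meridian_injective
  apply singularHomology_map_homeomorph_injective G.homeomorphU 1
  rw [map_zsmul, map_zsmul]
  exact hkl

/-- **`H₁(V; ℤ) = ℤ gV`.** [folklore] -/
theorem exists_eq_zsmul_gV (x : singularHomology ℤ ℤ ↥G.V 1) : ∃ k : ℤ, x = k • G.gV := by
  obtain ⟨x, rfl⟩ := singularHomology_map_homeomorph_surjective G.homeomorphV 1 x
  obtain ⟨k, rfl⟩ := solidTorus.exists_eq_zsmul_loopClass_loop
    ((2⁻¹ : ℝ) • ((circlePoint 0 : 𝕊 1) : 𝔼 2)) (norm_half_smul_lt _) x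
  exact ⟨k, by rw [map_zsmul]; rfl⟩

/-- **`gV` has infinite order.** [folklore] -/
theorem zsmul_gV_injective : Injective fun k : ℤ => k • G.gV := by
  intro k l hkl
  apply solidTorus.zsmul_loopClass_loop_injective _ (norm_half_smul_lt (circlePoint 0))
  apply singularHomology_map_homeomorph_injective G.homeomorphV 1
  rw [map_zsmul, map_zsmul]
  exact hkl

/-- **`H₁(U ∩ V; ℤ)` is generated by `A` and `B`.** [folklore] -/
theorem exists_eq_zsmul_genA_add_zsmul_genB (z : singularHomology ℤ ℤ ↥(G.U ∩ G.V) 1) :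
    ∃ i j : ℤ, z = i • G.genA + j • G.genB := by
  obtain ⟨z, rfl⟩ := singularHomology_map_homeomorph_surjective G.homeomorphW 1 z
  obtain ⟨i, j, rfl⟩ := surgeryModel.exists_eq_zsmul_add_zsmul z
  exact ⟨i, j, by rw [map_add, map_zsmul, map_zsmul]; rfl⟩

/-- **`A` has infinite order modulo `B`** in `H₁(U ∩ V; ℤ)`. [folklore] -/
theorem eq_zero_of_zsmul_genA_add_zsmul_genB_eq_zero {i j : ℤ}
    (h : i • G.genA + j • G.genB = 0) : i = 0 := by
  apply surgeryModel.eq_zero_of_zsmul_add_zsmul_eq_zero (j := j)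
  apply singularHomology_map_homeomorph_injective G.homeomorphW 1
  rw [map_add, map_zsmul, map_zsmul, map_zero]
  exact h

/-! ### Mayer–Vietoris for `Y = U ∪ V`: the first map on the generators -/

/-- `i_{U*} A = m • gU`: in `U` the longitudinal loop is the `m`-framed longitude of the knot,
`m` times the meridian. [folklore] -/
theorem map_left_genA {m : ℤ} (hν : G.ν.HasFraming m) :
    singularHomology.map ℤ ℤ (subsetInclusion (inter_subset_left : G.U ∩ G.V ⊆ G.U)) 1 G.genA =
      m • G.gU := by
  have hc : (subsetInclusion (inter_subset_left : G.U ∩ G.V ⊆ G.U)).comp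
      (G.homeomorphW : C((𝕊 1) × ↥puncturedDisc, ↥(G.U ∩ G.V))) =
      (G.homeomorphU : C(↥K.complement, ↥G.U)).comp (surgeryModel.toComplement G.ν) :=
    ContinuousMap.ext G.subsetInclusion_left_homeomorphW
  rw [genA, gU, ← ModuleCat.comp_apply, ← singularHomology.map_comp, hc, singularHomology.map_comp,
    ModuleCat.comp_apply, map_loopClass, G.loopClass_lonLoop_map_toComplement,
    G.ν.loopClass_longitude_eq_of_hasFraming hν, map_zsmul]

/-- `i_{U*} B = gU`: in `U` the meridional loop is the meridian of the knot. [folklore] -/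
theorem map_left_genB :
    singularHomology.map ℤ ℤ (subsetInclusion (inter_subset_left : G.U ∩ G.V ⊆ G.U)) 1 G.genB =
      G.gU := by
  have hc : (subsetInclusion (inter_subset_left : G.U ∩ G.V ⊆ G.U)).comp
      (G.homeomorphW : C((𝕊 1) × ↥puncturedDisc, ↥(G.U ∩ G.V))) =
      (G.homeomorphU : C(↥K.complement, ↥G.U)).comp (surgeryModel.toComplement G.ν) :=
    ContinuousMap.ext G.subsetInclusion_left_homeomorphW
  rw [genB, gU, ← ModuleCat.comp_apply, ← singularHomology.map_comp, hc, singularHomology.map_comp,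
    ModuleCat.comp_apply, map_loopClass, G.loopClass_merLoop_map_toComplement]

/-- `i_{V*} A = 0`: in `V` the longitudinal loop bounds a meridian disc of the new solid torus.
[folklore] -/
theorem map_right_genA :
    singularHomology.map ℤ ℤ (subsetInclusion (inter_subset_right : G.U ∩ G.V ⊆ G.V)) 1 G.genA =
      0 := by
  have hc : (subsetInclusion (inter_subset_right : G.U ∩ G.V ⊆ G.V)).comp
      (G.homeomorphW : C((𝕊 1) × ↥puncturedDisc, ↥(G.U ∩ G.V))) =
      (G.homeomorphV : C(↥solidTorus, ↥G.V)).comp surgeryModel.toSolidTorus :=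
    ContinuousMap.ext G.subsetInclusion_right_homeomorphW
  rw [genA, ← ModuleCat.comp_apply, ← singularHomology.map_comp, hc, singularHomology.map_comp,
    ModuleCat.comp_apply, map_loopClass, loopClass_lonLoop_map_toSolidTorus, map_zero]

/-- `i_{V*} B = gV`: in `V` the meridional loop is the longitudinal generator. [folklore] -/
theorem map_right_genB :
    singularHomology.map ℤ ℤ (subsetInclusion (inter_subset_right : G.U ∩ G.V ⊆ G.V)) 1 G.genB =
      G.gV := by
  have hc : (subsetInclusion (inter_subset_right : G.U ∩ G.V ⊆ G.V)).comp
      (G.homeomorphW : C((𝕊 1) × ↥puncturedDisc, ↥(G.U ∩ G.V))) =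
      (G.homeomorphV : C(↥solidTorus, ↥G.V)).comp surgeryModel.toSolidTorus :=
    ContinuousMap.ext G.subsetInclusion_right_homeomorphW
  rw [genB, gV, ← ModuleCat.comp_apply, ← singularHomology.map_comp, hc, singularHomology.map_comp,
    ModuleCat.comp_apply, map_loopClass, loopClass_merLoop_map_toSolidTorus]

/-- The first Mayer–Vietoris map `φ = (i_{U*}, -i_{V*})` in degree one. [folklore] -/
abbrev mvφ : singularHomology ℤ ℤ ↥(G.U ∩ G.V) 1 ⟶
    singularHomology ℤ ℤ ↥G.U 1 ⊞ singularHomology ℤ ℤ ↥G.V 1 :=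
  mayerVietoris.φ ℤ ℤ G.U G.V 1

/-- First component of `φ (i A + j B)`: `(i m + j) gU`. [folklore] -/
theorem fst_mvφ_apply {m : ℤ} (hν : G.ν.HasFraming m) (i j : ℤ) :
    (biprod.fst : singularHomology ℤ ℤ ↥G.U 1 ⊞ singularHomology ℤ ℤ ↥G.V 1 ⟶ _)
        (G.mvφ (i • G.genA + j • G.genB)) = (i * m + j) • G.gU := by
  rw [mvφ, mayerVietoris.φ, biprod_fst_lift_apply, map_add, map_zsmul, map_zsmul,
    G.map_left_genA hν, G.map_left_genB, add_zsmul, mul_zsmul]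

/-- Second component of `φ (i A + j B)`: `-(j gV)`. [folklore] -/
theorem snd_mvφ_apply (i j : ℤ) :
    (biprod.snd : singularHomology ℤ ℤ ↥G.U 1 ⊞ singularHomology ℤ ℤ ↥G.V 1 ⟶ _)
        (G.mvφ (i • G.genA + j • G.genB)) = -(j • G.gV) := by
  rw [mvφ, mayerVietoris.φ, biprod_snd_lift_apply]
  change -(singularHomology.map ℤ ℤ (subsetInclusion inter_subset_right) 1 (i • G.genA + j • G.genB)) = _
  rw [map_add, map_zsmul, map_zsmul, G.map_right_genA, G.map_right_genB, zsmul_zero, zero_add]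

/-- **The kernel of `φ`**: `φ (i A + j B) = 0` iff `j = 0` and `i m = 0`. [folklore] -/
theorem mvφ_apply_eq_zero_iff {m : ℤ} (hν : G.ν.HasFraming m) (i j : ℤ) :
    G.mvφ (i • G.genA + j • G.genB) = 0 ↔ j = 0 ∧ i * m = 0 := by
  constructor
  · intro h
    have h1 := G.fst_mvφ_apply hν i j
    have h2 := G.snd_mvφ_apply i j
    rw [h, map_zero] at h1 h2
    have hj : j = 0 := G.zsmul_gV_injective ((neg_eq_zero.1 h2.symm).trans (zero_zsmul _).symm)
    refine ⟨hj, G.zsmul_gU_injective ?_⟩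
    change (i * m) • G.gU = 0 • G.gU
    rw [zero_zsmul, ← add_zero (i * m), ← hj, h1]
  · rintro ⟨rfl, him⟩
    apply biprod_apply_ext
    · rw [G.fst_mvφ_apply hν, him, zero_add, zero_zsmul, map_zero]
    · rw [G.snd_mvφ_apply, zero_zsmul, neg_zero, map_zero]

end Homology

/-! ### Mayer–Vietoris for `Y = U ∪ V`: exactness and the computation -/

section Main

variable {K : Knot} {Y : Type} [TopologicalSpace Y] (G : DehnSurgeryDatum K Y)

/-- **`H₂(U; ℤ) = 0`**: `U ≅ S³ ∖ K` and `H₂(S³ ∖ K) = 0` (Alexander duality; Hatcher (2002),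
Prop. 2B.1 (b), the tree's `SphereComplement.isZero_compl_range_of_isEmbedding_holds`).
[cite: HatcherAT2002, Prop. 2B.1] -/
theorem isZero_singularHomology_U_two : IsZero (singularHomology ℤ ℤ ↥G.U 2) := by
  have hK : IsZero (singularHomology ℤ ℤ ↥K.complement 2) :=
    SphereComplement.isZero_compl_range_of_isEmbedding_holds ℤ ℤ (⇑K) K.isEmbedding
      (by norm_num) two_ne_zero (by norm_num)
  exact hK.of_iso (singularHomology.mapIso ℤ ℤ G.homeomorphU 2).symm

/-- **`H₂(V; ℤ) = 0`**: `V ≅ D̊² × 𝕊¹ ≃ 𝕊¹`. [folklore] -/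
theorem isZero_singularHomology_V_two : IsZero (singularHomology ℤ ℤ ↥G.V 2) :=
  solidTorus.isZero_singularHomology_two.of_iso (singularHomology.mapIso ℤ ℤ G.homeomorphV 2).symm

/-- The Mayer–Vietoris connecting map `δ : Hₙ₊₁(Y) → Hₙ(U ∩ V)` of the cover `Y = U ∪ V`
(excision discharged by the tree's `isIso_map_of_interior_union_interior_holds`). [folklore] -/
abbrev mvδ (n : ℕ) : singularHomology ℤ ℤ Y (n + 1) ⟶ singularHomology ℤ ℤ ↥(G.U ∩ G.V) n :=
  mayerVietoris.δ ℤ ℤ G.U G.V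
    (relativeSingularHomology.isIso_map_of_interior_union_interior_holds ℤ ℤ Y)
    G.interior_U_union_interior_V n

/-- The second Mayer–Vietoris map `ψ : Hₙ(U) ⊞ Hₙ(V) → Hₙ(Y)`. [folklore] -/
abbrev mvψ (n : ℕ) : singularHomology ℤ ℤ ↥G.U n ⊞ singularHomology ℤ ℤ ↥G.V n ⟶
    singularHomology ℤ ℤ Y n :=
  mayerVietoris.ψ ℤ ℤ G.U G.V n

/-- **`δ : H₂(Y) → H₁(U ∩ V)` is injective** (`H₂(U) = H₂(V) = 0` and exactness at `H₂(Y)`,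
Hatcher (2002), §2.2). [cite: HatcherAT2002, §2.2 p. 149] -/
theorem mono_mvδ_one : Mono (G.mvδ 1) := by
  have hψ : mayerVietoris.ψ ℤ ℤ G.U G.V 2 = 0 :=
    ((biprod_isZero_iff _ _).2
      ⟨G.isZero_singularHomology_U_two, G.isZero_singularHomology_V_two⟩).eq_of_src _ _
  exact (mayerVietoris.exact₂_holds ℤ ℤ G.U G.V
    (relativeSingularHomology.isIso_map_of_interior_union_interior_holds ℤ ℤ Y) G.interior_U_union_interior_V 1).mono_g hψ

/-- **`im δ = ker φ`** in degree one (exactness at `H₁(U ∩ V)`, Hatcher (2002), §2.2).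
[cite: HatcherAT2002, §2.2 p. 149] -/
theorem range_mvδ_one_eq_ker : LinearMap.range (G.mvδ 1).hom = LinearMap.ker G.mvφ.hom :=
  (mayerVietoris.exact₃_holds ℤ ℤ G.U G.V
    (relativeSingularHomology.isIso_map_of_interior_union_interior_holds ℤ ℤ Y) G.interior_U_union_interior_V 1).moduleCat_range_eq_ker

/-- **`δ : H₁(Y) → H₀(U ∩ V)` vanishes** (`U ∩ V` is path connected, so `H₀(U ∩ V) → H₀(U)`
is injective; Hatcher (2002), §2.2 and Prop. 2.7). [cite: HatcherAT2002, §2.2 p. 149] -/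
theorem mvδ_zero_eq_zero : G.mvδ 0 = 0 := by
  have hφ : Mono (mayerVietoris.φ ℤ ℤ G.U G.V 0) := by
    haveI := singularHomology.mono_map_zero_of_pathConnectedSpace ℤ ℤ
      (subsetInclusion (inter_subset_left : G.U ∩ G.V ⊆ G.U))
    exact mono_of_mono_fac (biprod.lift_fst _ _)
  exact zero_of_comp_mono _ (mayerVietoris.δ_comp_φ ℤ ℤ G.U G.V
    (relativeSingularHomology.isIso_map_of_interior_union_interior_holds ℤ ℤ Y) G.interior_U_union_interior_V 0)

/-- **`ψ : H₁(U) ⊞ H₁(V) → H₁(Y)` is onto** (exactness at `H₁(Y)`). [cite: HatcherAT2002, §2.2 p. 149] -/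
theorem epi_mvψ_one : Epi (G.mvψ 1) :=
  (mayerVietoris.exact₂_holds ℤ ℤ G.U G.V
    (relativeSingularHomology.isIso_map_of_interior_union_interior_holds ℤ ℤ Y)
    G.interior_U_union_interior_V 0).epi_f G.mvδ_zero_eq_zero

/-- **`im φ = ker ψ`** in degree one (exactness at `H₁(U) ⊞ H₁(V)`). [cite: HatcherAT2002, §2.2 p. 149] -/
theorem range_mvφ_eq_ker : LinearMap.range G.mvφ.hom = LinearMap.ker (G.mvψ 1).hom :=
  (mayerVietoris.exact₁_holds ℤ ℤ G.U G.V G.interior_U_union_interior_V 1).moduleCat_range_eq_ker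

/-- Every class of `H₂(Y)` has `δ`-image `i A + j B` with `j = 0` and `i m = 0`. [folklore] -/
theorem exists_mvδ_eq {m : ℤ} (hν : G.ν.HasFraming m) (y : singularHomology ℤ ℤ Y 2) :
    ∃ i : ℤ, G.mvδ 1 y = i • G.genA ∧ i * m = 0 := by
  have hy : G.mvδ 1 y ∈ LinearMap.ker G.mvφ.hom := by
    rw [← G.range_mvδ_one_eq_ker]
    exact LinearMap.mem_range_self _ y
  obtain ⟨i, j, hij⟩ := G.exists_eq_zsmul_genA_add_zsmul_genB (G.mvδ 1 y)
  rw [LinearMap.mem_ker] at hy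
  change G.mvφ (G.mvδ 1 y) = 0 at hy
  rw [hij, G.mvφ_apply_eq_zero_iff hν] at hy
  obtain ⟨rfl, him⟩ := hy
  refine ⟨i, ?_, him⟩
  rw [hij, zero_zsmul, add_zero]

/-- **`H₂(S³_m(K); ℤ) = 0` for `m ≠ 0`** (standard; Mayer–Vietoris as in Hatcher (2002), §2.2).
[folklore] -/
theorem isZero_singularHomology_two {m : ℤ} (hν : G.ν.HasFraming m) (hm : m ≠ 0) :
    IsZero (singularHomology ℤ ℤ Y 2) := by
  have hinj : Injective (G.mvδ 1) := (ModuleCat.mono_iff_injective _).1 G.mono_mvδ_one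
  have key : ∀ y : singularHomology ℤ ℤ Y 2, y = 0 := by
    intro y
    obtain ⟨i, hi, him⟩ := G.exists_mvδ_eq hν y
    have hi0 : i = 0 := (mul_eq_zero.1 him).resolve_right hm
    rw [hi0, zero_zsmul] at hi
    exact hinj (hi.trans (map_zero _).symm)
  haveI : Subsingleton (singularHomology ℤ ℤ Y 2) := ⟨fun a b => (key a).trans (key b).symm⟩
  exact ModuleCat.isZero_of_subsingleton _

/-- **`H₂(S³_0(K); ℤ) ≅ ℤ`**, generated by the class with `δ`-image the longitude `A`
("`Ŝ` generates `H₂(M)`", Gabai (1987), proof of Cor. 8.2). [cite: GabaiJDG1987, Def. 8.1; Cor. 8.2] -/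
theorem nonempty_addEquiv_singularHomology_two (hν : G.ν.HasFraming 0) :
    Nonempty (singularHomology ℤ ℤ Y 2 ≃+ ℤ) := by
  have hinj : Injective (G.mvδ 1) := (ModuleCat.mono_iff_injective _).1 G.mono_mvδ_one
  have hA : G.genA ∈ LinearMap.range (G.mvδ 1).hom := by
    rw [G.range_mvδ_one_eq_ker, LinearMap.mem_ker]
    have h := (G.mvφ_apply_eq_zero_iff hν 1 0).2 ⟨rfl, mul_zero _⟩
    rwa [one_zsmul, zero_zsmul, add_zero] at h
  obtain ⟨y₀, hy₀⟩ := hA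
  change G.mvδ 1 y₀ = G.genA at hy₀
  have hbij : Bijective (zmultiplesHom (singularHomology ℤ ℤ Y 2) y₀) := by
    constructor
    · intro k l hkl
      simp only [zmultiplesHom_apply] at hkl
      have h := congrArg (G.mvδ 1) hkl
      rw [map_zsmul, map_zsmul, hy₀] at h
      have h0 : (k - l) • G.genA + (0 : ℤ) • G.genB = 0 := by
        rw [zero_zsmul, add_zero, sub_zsmul, h]
        abel
      exact sub_eq_zero.1 (G.eq_zero_of_zsmul_genA_add_zsmul_genB_eq_zero h0)
    · intro y
      obtain ⟨i, hi, -⟩ := G.exists_mvδ_eq hν y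
      refine ⟨i, hinj ?_⟩
      rw [zmultiplesHom_apply, map_zsmul, hy₀, hi]
  exact ⟨(AddEquiv.ofBijective _ hbij).symm⟩

/-- **`H₁(S³_m(K); ℤ) ≅ ℤ/m`** (standard: `H₁` of surgery on a framed link is presented by the
linking matrix, here the `1 × 1` matrix `(m)`; cf. Gompf–Stipsicz (1999), §5.3; in particular
`H₁(S³_0(K)) ≅ ℤ` — Gabai (1987), Def. 8.1: the zero frame surgery is "a homology `S² × S¹`").
[folklore] -/
theorem nonempty_addEquiv_singularHomology_one {m : ℤ} (hν : G.ν.HasFraming m) :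
    Nonempty (singularHomology ℤ ℤ Y 1 ≃+ ZMod m.natAbs) := by
  set P := singularHomology ℤ ℤ ↥G.U 1 ⊞ singularHomology ℤ ℤ ↥G.V 1 with hP
  -- coordinates on `H₁(U) = ℤ gU`, `H₁(V) = ℤ gV`
  have hUbij : Bijective (zmultiplesHom _ G.gU) :=
    ⟨fun k l h => G.zsmul_gU_injective (by simpa only [zmultiplesHom_apply] using h),
      fun x => by obtain ⟨k, rfl⟩ := G.exists_eq_zsmul_gU x; exact ⟨k, rfl⟩⟩
  have hVbij : Bijective (zmultiplesHom _ G.gV) :=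
    ⟨fun k l h => G.zsmul_gV_injective (by simpa only [zmultiplesHom_apply] using h),
      fun x => by obtain ⟨k, rfl⟩ := G.exists_eq_zsmul_gV x; exact ⟨k, rfl⟩⟩
  set cU : singularHomology ℤ ℤ ↥G.U 1 ≃+ ℤ := (AddEquiv.ofBijective _ hUbij).symm with hcU
  set cV : singularHomology ℤ ℤ ↥G.V 1 ≃+ ℤ := (AddEquiv.ofBijective _ hVbij).symm with hcV
  have cU_gU : ∀ k : ℤ, cU (k • G.gU) = k := fun k =>
    (AddEquiv.ofBijective _ hUbij).symm_apply_eq.2 rfl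
  have cV_gV : ∀ k : ℤ, cV (k • G.gV) = k := fun k =>
    (AddEquiv.ofBijective _ hVbij).symm_apply_eq.2 rfl
  -- the functional `g (a gU, b gV) = a + b mod m`
  set g : P →+ ZMod m.natAbs := (Int.castAddHom (ZMod m.natAbs)).comp
    ((cU.toAddMonoidHom.comp (biprod.fst : P ⟶ _).hom.toAddMonoidHom) +
      (cV.toAddMonoidHom.comp (biprod.snd : P ⟶ _).hom.toAddMonoidHom)) with hg
  have g_apply : ∀ x : P, g x = ((cU ((biprod.fst : P ⟶ _) x) + cV ((biprod.snd : P ⟶ _) x) : ℤ) :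
      ZMod m.natAbs) := fun x => rfl
  have hm0 : ((m : ℤ) : ZMod m.natAbs) = 0 :=
    (CharP.intCast_eq_zero_iff (ZMod m.natAbs) m.natAbs m).2 (Int.natAbs_dvd.2 dvd_rfl)
  -- `g ∘ φ = 0`
  have gφ : ∀ z, g (G.mvφ z) = 0 := by
    intro z
    obtain ⟨i, j, rfl⟩ := G.exists_eq_zsmul_genA_add_zsmul_genB z
    rw [g_apply, G.fst_mvφ_apply hν, G.snd_mvφ_apply, ← neg_zsmul, cU_gU, cV_gV,
      add_neg_cancel_right, Int.cast_mul, hm0, mul_zero]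
  -- `ker g ⊆ im φ`
  have kerg : ∀ x : P, g x = 0 → ∃ z, G.mvφ z = x := by
    intro x hx
    obtain ⟨a, ha⟩ := G.exists_eq_zsmul_gU ((biprod.fst : P ⟶ _) x)
    obtain ⟨b, hb⟩ := G.exists_eq_zsmul_gV ((biprod.snd : P ⟶ _) x)
    rw [g_apply, ha, hb, cU_gU, cV_gV] at hx
    obtain ⟨c, hc⟩ : m ∣ a + b :=
      Int.natAbs_dvd.1 ((CharP.intCast_eq_zero_iff (ZMod m.natAbs) m.natAbs (a + b)).1 hx)
    refine ⟨c • G.genA + (-b) • G.genB, biprod_apply_ext ?_ ?_⟩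
    · rw [G.fst_mvφ_apply hν, ha]
      congr 1
      linarith
    · rw [G.snd_mvφ_apply, hb, neg_zsmul, neg_neg]
  -- `g` is onto
  have gsurj : Surjective g := by
    intro r
    obtain ⟨a, rfl⟩ := ZMod.intCast_surjective r
    refine ⟨(biprod.inl : _ ⟶ P) (a • G.gU), ?_⟩
    rw [g_apply, biprod_fst_inl_apply, biprod_snd_inl_apply, cU_gU, map_zero, add_zero]
  -- `H₁(Y) ≅ P / ker ψ = P / im φ = P / ker g ≅ ℤ/m`
  have hψsurj : Surjective (G.mvψ 1).hom := (ModuleCat.epi_iff_surjective _).1 G.epi_mvψ_one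
  have hker : (G.mvψ 1).hom.toAddMonoidHom.ker = g.ker := by
    ext x
    rw [AddMonoidHom.mem_ker, AddMonoidHom.mem_ker, LinearMap.toAddMonoidHom_coe,
      ← LinearMap.mem_ker, ← G.range_mvφ_eq_ker, LinearMap.mem_range]
    constructor
    · rintro ⟨z, rfl⟩
      exact gφ z
    · exact kerg x
  exact ⟨(QuotientAddGroup.quotientKerEquivOfSurjective (G.mvψ 1).hom.toAddMonoidHom hψsurj).symm.trans
    ((QuotientAddGroup.quotientAddEquivOfEq hker).trans
      (QuotientAddGroup.quotientKerEquivOfSurjective g gsurj))⟩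

end Main

end DehnSurgeryDatum

/-! ### The statements for `IsIntegralSurgery` -/

section IntegralSurgery

variable {EY HY : Type*} [NormedAddCommGroup EY] [NormedSpace ℝ EY] [TopologicalSpace HY]
  {IY : ModelWithCorners ℝ EY HY} {Y : Type} [TopologicalSpace Y] [ChartedSpace HY Y]
  {K : Knot} {m : ℤ}

/-- **`H₁(S³_m(K); ℤ) ≅ ℤ/m`** for the result `Y` of `m`-surgery on a knot `K ⊆ S³` (standard,
the `1 × 1` case of "`H₁` of surgery on a framed link is presented by the linking matrix",
cf. Gompf–Stipsicz (1999), §5.3; `ZMod 0 = ℤ`). [folklore] -/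
theorem IsIntegralSurgery.nonempty_addEquiv_singularHomology_one (h : IsIntegralSurgery IY Y K m) :
    Nonempty (singularHomology ℤ ℤ Y 1 ≃+ ZMod m.natAbs) := by
  obtain ⟨G, hν⟩ := h.exists_dehnSurgeryDatum
  exact G.nonempty_addEquiv_singularHomology_one hν

/-- The same as a `ℤ`-linear equivalence. [folklore] -/
theorem IsIntegralSurgery.nonempty_linearEquiv_singularHomology_one (h : IsIntegralSurgery IY Y K m) :
    Nonempty (singularHomology ℤ ℤ Y 1 ≃ₗ[ℤ] ZMod m.natAbs) := by
  obtain ⟨e⟩ := h.nonempty_addEquiv_singularHomology_one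
  exact ⟨e.toIntLinearEquiv⟩

/-- **`H₂(S³_m(K); ℤ) = 0` for `m ≠ 0`** (standard; only the zero frame surgery on `K` has
`H₂ ≠ 0`, cf. Gabai (1987), Def. 8.1). [folklore] -/
theorem IsIntegralSurgery.isZero_singularHomology_two (h : IsIntegralSurgery IY Y K m) (hm : m ≠ 0) :
    IsZero (singularHomology ℤ ℤ Y 2) := by
  obtain ⟨G, hν⟩ := h.exists_dehnSurgeryDatum
  exact G.isZero_singularHomology_two hν hm

/-- **Zero frame surgery is a homology `S² × S¹`, degree one: `H₁(S³_0(K); ℤ) ≅ ℤ`**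
(Gabai (1987), Def. 8.1). [cite: GabaiJDG1987, Def. 8.1] -/
theorem IsIntegralSurgery.nonempty_addEquiv_singularHomology_one_int (h : IsIntegralSurgery IY Y K 0) :
    Nonempty (singularHomology ℤ ℤ Y 1 ≃+ ℤ) :=
  h.nonempty_addEquiv_singularHomology_one

/-- **Zero frame surgery is a homology `S² × S¹`, degree two: `H₂(S³_0(K); ℤ) ≅ ℤ`**
(Gabai (1987), Def. 8.1; Cor. 8.2: generated by the capped-off Seifert surface `Ŝ`).
[cite: GabaiJDG1987, Def. 8.1] -/
theorem IsIntegralSurgery.nonempty_addEquiv_singularHomology_two_int (h : IsIntegralSurgery IY Y K 0) :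
    Nonempty (singularHomology ℤ ℤ Y 2 ≃+ ℤ) := by
  obtain ⟨G, hν⟩ := h.exists_dehnSurgeryDatum
  exact G.nonempty_addEquiv_singularHomology_two hν

/-- **Zero frame surgery is the unique integral surgery on `K` with infinite `H₁`** ("`M` is
the unique manifold obtained by Dehn surgery on `k` which is a homology `S² × S¹`", Gabai (1987),
Def. 8.1, for integral framings): `H₁(S³_m(K); ℤ) ≅ ℤ` iff `m = 0`. [cite: GabaiJDG1987, Def. 8.1] -/
theorem IsIntegralSurgery.nonempty_addEquiv_singularHomology_one_int_iff (h : IsIntegralSurgery IY Y K m) :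
    Nonempty (singularHomology ℤ ℤ Y 1 ≃+ ℤ) ↔ m = 0 := by
  refine ⟨fun ⟨e⟩ => ?_, fun hm => ?_⟩
  · obtain ⟨f⟩ := h.nonempty_addEquiv_singularHomology_one
    by_contra hm
    haveI : NeZero m.natAbs := ⟨Int.natAbs_ne_zero.2 hm⟩
    haveI : Finite ℤ := Finite.of_equiv _ (e.symm.trans f).symm.toEquiv
    exact not_finite ℤ
  · subst hm
    exact h.nonempty_addEquiv_singularHomology_one

end IntegralSurgery

end Literature.Topology.FourManifolds
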